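import Mathlib
import HarnessLib
import HarnessLib.Audit
import Summits.MatrixMultiplication.Statement
import Literature.Computability.AlgebraicComplexity.FlatteningBound
import HarnessLib.Audit.Status.Attr

/-!
Route: KroneckerRatioLaw

DORMANT since 2026-08-24T09:07:48Z (reconciler: no traction for 6.6 d (last activity item-evidence-added at 2026-08-17T16:55:29Z); parked, not closed — `ledger route dormant route-MatrixMultiplication-KroneckerRatioLaw --off` to reactiv) — unstaffed, not closed; items shared with open routes are served there. `ledger route dormant <id> --off` reactivates.

# Route KroneckerRatioLaw — omega is a monotone limit — if ONE Kronecker tower has non-decreasing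
excess R<Nm^k>/(Nm^k)^omega, the efficient steps that omega = 2 forces on every tower give omega = 2

Write g(N) := R(<N,N,N>) (tensor rank over C) and h(N) := g(N)/N^omega >= 1 for the finite EXCESS
over the asymptotic rate (h(N) > 1 for
N >= 2 is Coppersmith–Winograd 1982, "omega is an infimum, not a minimum"). It suffices to show X =
X1 ∧ X2 (re-glued 2026-08-17 on the WEAKEST
law the deciding theorem consumes; the general law ExcessMonotone and the one-step witness
TowerWitness of rev 0 stay as supports):
X1 = MonotoneTower (the law, crux 2): SOME Kronecker tower N, Nm, Nm^2, … (N >= 1, m >= 2) has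
monotone excess — m^omega · g(N m^k) <= g(N m^(k+1))
for every k (h non-decreasing along that tower). Implied by the general two-level law ExcessMonotone
(support MonotoneTowerOfExcessMonotone, proved),
which in turn follows from the card's ratio-monotonicity RM_MM (support RatioLawGivesExcess, proved)
and from the divisor-lattice DR law (support).
X2 = EfficientSteps (the witness, crux 3): EVERY Kronecker tower has (1+eps)-efficient steps for
every eps > 0 — some k with
g(N m^(k+1)) <= (1+eps) m^2 g(N m^k). A PROVED consequence of omega = 2 (support
EfficientStepsOfExponentTwo, sorry-free in the planner folder:
if every step of a tower cost > (1+eps) m^2 then g(N m^k) > ((1+eps) m^2)^k, against g(n) =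
O(n^(2+eta)) with m^eta = sqrt(1+eps)); strictly weaker
than the summit; implies the rev-0 witness TowerWitness (support).
Then the monotone tower's law at the efficient step k reads m^omega g <= g' <= (1+eps) m^2 g with g
= g(N m^k) > 0, so m^omega <= (1+eps) m^2 for
every eps: omega = 2. Conversely omega = 2 gives X2 outright, so the route's open content is exactly
X1: "is there a single tower along which savings,
once made, are never given back?" Realises card kronecker-ratio-law (its de-asymptotised law "c_k
non-decreasing" along towers), with the critic's
correction (the general-TENSOR law is false — direct sums <n,n,1> ⊕ <1,1,n>; only
matrix-multiplication towers are asserted).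
Lean: `(∃ N m : ℕ, 1 ≤ N ∧ 2 ≤ m ∧ ∀ k : ℕ, (m : ℝ) ^
Literature.Computability.AlgebraicComplexity.omega ℂ *
(Literature.Computability.AlgebraicComplexity.tensorRank
(Literature.Computability.AlgebraicComplexity.matMulTensor ℂ (N * m ^ k) (N * m ^ k) (N * m ^ k)) :
ℝ) ≤ (Literature.Computability.AlgebraicComplexity.tensorRank
(Literature.Computability.AlgebraicComplexity.matMulTensor ℂ (N * m ^ (k + 1)) (N * m ^ (k + 1)) (N
* m ^ (k + 1))) : ℝ)) ∧ (∀ N m : ℕ, 1 ≤ N → 2 ≤ m → ∀ ε : ℝ, 0 < ε → ∃ k : ℕ,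
(Literature.Computability.AlgebraicComplexity.tensorRank
(Literature.Computability.AlgebraicComplexity.matMulTensor ℂ (N * m ^ (k + 1)) (N * m ^ (k + 1)) (N
* m ^ (k + 1))) : ℝ) ≤ (1 + ε) * (m : ℝ) ^ 2 *
(Literature.Computability.AlgebraicComplexity.tensorRank
(Literature.Computability.AlgebraicComplexity.matMulTensor ℂ (N * m ^ k) (N * m ^ k) (N * m ^ k)) :
ℝ))`

## Assembly
Real analysis only (deciding theorem `closes`, proved sorry-free): omega >= 2 is the tree's
flattening bound `omega_two_le`; for omega <= 2 + delta take
the monotone tower (N, m) of MonotoneTower and EfficientSteps on it at eps := delta·log 2, giving k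
with g(N m^(k+1)) <= (1+eps) m^2 g(N m^k); the law
at k gives m^omega g(N m^k) <= g(N m^(k+1)); g(N m^k) >= (N m^k)^2 >= 1 > 0 cancels, m^omega <=
(1+eps) m^2, and logs give
omega·log m <= log(1+eps) + 2 log m <= eps + 2 log m <= (2+delta) log m.

Rationale: WHY THIS LINE. Every known finite-to-asymptotic transfer for omega is FIRST ORDER — one level N read
through a k-th root, omega <= log_N g(N) — and
CoppersmithWinograd1982 proves every such certificate strict (tree:
Literature.Barriers.MatrixMultiplication.InfimumNotMinimumBarrier), so no finite
rank cell has asymptotic meaning today. The lever here is a MONOTONICITY LAW ON THE RANK FUNCTION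
ITSELF along Kronecker towers: the excess h(N) is
>= 1 (Bläser 2013 Thm 5.9, tree `omega_le_logb_tensorRank_matMulTensor`), equals 1 only at N = 1,
and the law says it never decreases when a
Kronecker factor <m> is appended. Rev 1 (2026-08-17) re-glues the route on the WEAKEST form the
deciding theorem consumes: ONE monotone tower
(MonotoneTower) suffices, because omega = 2 itself forces (1+eps)-efficient steps on EVERY tower
(EfficientSteps, PROVED from omega = 2 in the planner
folder) — so omega = 2 is EQUIVALENT to MonotoneTower ∧ EfficientSteps with the second conjunct a
theorem-in-waiting, and the route's open content is
the single question "is there a tower along which savings, once made, are never given back?". The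
stronger forms are kept as the LINE, each a
support item with its implication proved: the general two-level law ExcessMonotone (every pair (N,
m); MonotoneTowerOfExcessMonotone), under which
every pair of finite levels is a two-sided omega-certificate (upper: omega <= log_m(g(Nm)/g(N)),
today (2,2) -> log_2(48/7) = 2.78, a rank-36 <4,4,4>
scheme -> 2.36; lower: g(Nm) >= m^2 g(N), e.g. R(<6,6,6>) >= 4·19 = 76 beyond Bläser's 72); the
card's SECOND-ORDER ratio monotonicity RM_MM
(log-concavity of k -> g(N m^k); RatioLawGivesExcess, proof in hand; teeth g(4)^2 >= 7 g(8) >= 7·136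
=> R(<4,4,4>) >= 31, and R(<8,8,8>) <= 329
demanded against the record 336 = 7·48); and the diminishing-returns law on the divisor lattice
(DiminishingReturnsGivesExcess) whose N = 1 face IS
submultiplicativity (a theorem, tree `Blaser2013_rank_matMulTensor_mul_le`) and whose M = m face is
RM_MM. Sources: card kronecker-ratio-law,
Zuiddam2015 (exact W-tower ranks), ConnerGesmundoLandsbergVentura2022, records Lacelle2026,
AlmanLi2026. Imported: nothing beyond real analysis and
the tree's exponent calculus; what is new relative to every open route is the object (monotone
excess / second differences of the rank FUNCTION
along towers, no intermediate tensor, no degeneration between levels): StrassenDefect works at the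
asymptotic level, where the floor
R~(<Nm>) >= m^omega R~(<N>) is a THEOREM and its witness is summit-strength; this route inverts the
roles (floor conjectural and now only along one
tower, witness PROVABLY a consequence of the summit); ShapeSubmodularity / CubicExchangeSplit live
on the SHAPE lattice (a,b,c) of rectangular
exponents, here the size towers of square ranks.

RANKED CRUXES. #2 MonotoneTower (crux) — some Kronecker tower (N >= 1, m >= 2) has monotone excess:
m^omega g(N m^k) <= g(N m^(k+1)) for all k.
#3 EfficientSteps (crux) — every Kronecker tower has, for every eps > 0, a step k with g(N m^(k+1))
<= (1+eps) m^2 g(N m^k); implied by omega = 2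
(support EfficientStepsOfExponentTwo, proved), the weakest statement the glue needs. Supports (all
implications proved in the planner folder, file
KRL_supports_holds): ExcessMonotone (rev-0 crux, the general law) and MonotoneTowerOfExcessMonotone;
TowerWitness (rev-0 crux) and
TowerWitnessOfEfficientSteps; RatioLawGivesExcess (RM_MM => law); DiminishingReturnsGivesExcess (DR
=> law); TowerWitnessOfExponentTwo;
EfficientStepsOfExponentTwo; PureTowerFace (the N = 1, k = 0 face, Bläser Thm 5.9).

TWO-LAYER PLAN. MonotoneTower ⇐ TowerLogConcave (RM_MM along ONE tower: g(N m^(k+2)) g(N m^k) <= g(N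
m^(k+1))^2 for all k) → RatioFloor (real
sequences, PROVED) → MonotoneTower (birth skeleton Lines/birth.lean, composition sorry-free: a
log-concave tower whose K-th level is >= (N m^K)^omega
can never step below m^omega). EfficientSteps ⇐ TowerSelfReduction (along every tower, rank-level
restrictions (<m^2> ⊗ <N m^k>) ⊕ J >= <N m^(k+1)>
with R(J) <= eps m^2 (N m^k)^2) → RankCalculus (restriction monotone, multiples, direct-sum
subadditivity) → EfficientSteps (birth skeleton,
composition sorry-free) — or simply omega = 2 by any other route. Nothing below that is filed now.

KILL CRITERIA. refuted:MonotoneTower needs a dip on EVERY tower and is out of reach of any known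
method (it would need matching upper/lower rank
bounds at two consecutive levels of infinitely many towers); the route is instead priced through its
LINE: refuted:ExcessMonotone — any proved pair
U(Nm) < m^2·L(N) (U an algorithm's rank, L a proved lower bound), e.g. a scheme R(<6,6,6>) <= 75
against Bläser's R(<3,3,3>) >= 19, or
R(<2m,2m,2m>) < 7m^2 — retires the general law and every certificate claim, leaving MonotoneTower
naked (tenure decision: close as exhausted unless
a specific tower is argued); RM_MM dies with a rank-30 scheme for <4,4,4> (g(4)^2 >= 7·136) or an
exhaustive proof that R(<8,8,8>) > g(4)^2/7.
refuted:EfficientSteps is impossible short of omega > 2 (it would refute the summit through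
EfficientStepsOfExponentTwo). Mooted (superseded) if
StrassenDefect.VanishingStrassenDefect is proved (omega = 2 directly).

NOT DECOMPOSED YET. The border-rank twin (g replaced by bR; same glue via Bini, teeth bR(<4,4,4>) >=
30 against Landsberg–Michałek's 29), the
prime-step/local-to-global split of DiminishingReturns, the direct-sum subadditivity lemma R(s ⊕ t)
<= R(s) + R(t) missing from the tree, and the
choice of WHICH tower to attack first (the doubling tower N = 1, m = 2 carries all exactly-known
data: g(1) = 1, g(2) = 7) — all layer-2, after a
refuter has priced the general law at small formats.

CHEAPEST FALSIFIER. A table check, done 2026-08-17 against the 2026 records (Lacelle2026: R<4,4,4>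
<= 48, R<6,6,6> <= 153, R<8,8,8> <= 336,
R<12,12,12> <= 1040; lower bounds Blaser1999 2.5n^2-3n, LandsbergMichalek2018 2n^2-log n-1): no pair
(N,m) has U(Nm) < m^2 L(N) (nearest: N=3, m=2
needs a <6,6,6> scheme of rank <= 75; N=2 needs R<4,4,4> <= 27, impossible), RM_MM is consistent
(7·336 > 48^2 only says the <4> saving must
re-compound at <8>: demand R<8,8,8> <= 329), DR consistent (7·1040 <= 48·153). Next cheapest: a kit
flip-graph walk (KauersMoosbauer2022) at <8,8,8>
seeded with 48 ⊗ 7 hunting rank <= 329 (confirms an RM instance on the doubling tower) and a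
Koszul–Young flattening computation for bR(<4,4,4>) >= 30.

NUMBERS. g(1) = 1, g(2) = 7 (exact); g(3) ∈ [19, 23]; g(4) ∈ [29, 48] (bR >= 29,
LandsbergMichalek2018); the general law needs g(4) >= 7·2^omega ∈
[28, 36.2] for omega ∈ [2, 2.3714]; records 2026 (Lacelle2026): <5,5,5> 93, <6,6,6> 153, <8,8,8>
336, <9,9,9> <= 504, <12,12,12> 1040; Bläser floor
2.5n^2 - 3n (Blaser1999): 72 at n=6, 136 at n=8; doubling-tower certificates today: (2 -> 4)
log_2(48/7) = 2.78, (1 -> 2) 2.81; omega < 2.371339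
(AlmanDuanVassilevskaWilliamsXuXuZhou2025).

DEFINITION REQUESTS. None: `tensorRank`, `matMulTensor`, `omega`, `admissibleExponents` exist
(Literature.Computability.AlgebraicComplexity.MatrixMultiplicationExponent).

Novelty: Searches (2026-08-17): `lit frontier MatrixMultiplication --since 2023` (30 rows; read AlmanLi2026
arXiv:2605.21738 §1–2: speedup theorems are first-order, R~ from border identities); `lit search
--hybrid "ratio R(2n)/R(n) matrix multiplication rank monotone"` (8 generic hits, BCS1997 pp.
452–456 read: only CW82 strictness); `lit galaxy search "tensor rank of Kronecker powers" /
"log-concave rank sequence tensor power" / "non-multiplicativity of tensor rank" --star all`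
(0/0/0), `--star pdf "Kronecker powers of tensors"` (4: Kopparty–Moshkovitz–Zuiddam geometric rank,
CGLVW geometric ARC, Landsberg Trieste survey — first order); `lit vsearch` paraphrase of the law
(8, none relevant); `lean search` TowerWitness / ExcessMonotone / MonotoneTower / RatioMonoton /
logConcave (no MatrixMultiplication decl); BC4 `exact?` on both cruxes against Mathlib + Literature
+ 10 Theses (fails); all 60 open route theses and the four closed tonight read at thesis/mechanism
level, StrassenDefect, ShapeSubmodularity, CubicExchangeSplit, CharacteristicContinuity,
CatalyticDegeneration, EPRFaces in full; card kronecker-ratio-law and its critic note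
(refuter-mechcritic-2280, 2026-08-16) in full.
Nearest prior art found: CoppersmithWinograd1982 (strictness n^omega < R(<n>) at ONE level = h(N) >
1, the law's k = 0 shadow); ConnerGesmundoLandsbergVentura2022 / arXiv:1909.04785 Thm 1.2 (k-th-root
one-level certificates through cw_q powers); Zuiddam2015 (exact W Kronecker-power ranks, first
order); Alman  [refs: 2605.21738, 1909.04785, AlmanLi2026, CoppersmithWinograd1982, ConnerGesmundoLandsbergVentura2022, Zuiddam2015]

Barriers (technique_class: kronecker-power-ranks, monotone-excess, finite-to-asymptotic): - technique_class: kronecker-power-ranks, monotone-excess, finite-to-asymptotic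
- Literature.Barriers.MatrixMultiplication.InfimumNotMinimumBarrier: evaded specifically — the
barrier (CoppersmithWinograd1982_strictASI) kills ONE-level certificates (a basic algorithm fed to
the τ-theorem is strict); the route never feeds one level to the τ-theorem: it compares TWO levels
under a monotonicity hypothesis, and CW82's strictness (h(N) > 1 = h(1)) is exactly the law's proved
N = 1 instance, consistent with it rather than against it; conceded: the law does not make omega
attained.
- Literature.Barriers.MatrixMultiplication.IrreversibilityBarrier: not in class — no intermediate
tensor, no relative exponent; only <N,N,N> and its own Kronecker multiples appear.
- Literature.Barriers.MatrixMultiplication.UniversalMethodBarrier: not in class — no degeneration of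
powers of a fixed tensor is used or claimed.
- Literature.Barriers.MatrixMultiplication.RectangularBarrier: not in class — square formats only;
the critic's counterexample to the GENERAL-tensor law (direct sums <n,n,1> ⊕ <1,1,n>, JaJa–Takche
additivity) is recorded and is why only matrix-multiplication towers are asserted.
- Literature.Barriers.MatrixMultiplication.LinearRankMethodBarrier: the conditional lower-bound
transfer g(Nm) >= m^omega g(N) is not a rank method (no matrix of linear forms) and claims no
unconditional bound.
- Literature.Barriers.MatrixMultiplication.TricoloredSumFreeBarrier: n/a (no group, no STPP/TPP);
lik

History (route lifecycle, newest last):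
- 2026-08-17T04:21:08Z · rev 5: dropped stmt-MatrixMultiplication-18413 — drop stmt-MatrixMultiplication-18413 (TripartitionDarkness, placeholder signature, another route's self-declared junk duplicate of stmt-18398): it got attached (planner-plan-novel-MatrixMultiplication-MatrixM-c775de46-v2-)
- 2026-08-17T04:21:21Z · rev 6: restated Assembly (stmt-MatrixMultiplication-19083) — restate the bookkeeping Assembly item to the rev-1 deciding shape (MonotoneTower → EfficientSteps → MatrixMultiplication = type of closes); no crux/support stat (planner-plan-novel-MatrixMultiplication-MatrixM-c775de46-v2-)
- 2026-08-24T09:07:48Z · DORMANT — reconciler: no traction for 6.6 d (last activity item-evidence-added at 2026-08-17T16:55:29Z); parked, not closed — `ledger route dormant route-MatrixMultiplica (operator:999:2589560)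

sub-problem: MatrixMultiplication · status: dormant · opened planner-plan-novel-MatrixMultiplication-MatrixM-c775de46-v2-g5-0 2026-08-17T03:48:55Z · rev 6 · ledger route-MatrixMultiplication-KroneckerRatioLaw
GENERATED by the gate from the ledger (D-0016/17). Provers cite these decls: `theorem foo : Summit.MatrixMultiplication.MatrixMultiplication.Theses.KroneckerRatioLaw.<Decl> := …` in Summits/MatrixMultiplication/MatrixMultiplication/Theorems/<Name>.lean.
-/

namespace Summit.MatrixMultiplication.MatrixMultiplication.Theses.KroneckerRatioLaw

open scoped BigOperators Topology Manifold Classical MeasureTheory ProbabilityTheory Matrix InnerProductSpace ComplexConjugate ContinuousMap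
open Filter Set Function TopologicalSpace MeasureTheory

attribute [summit_statement] _root_.MatrixMultiplication

/-- item stmt-MatrixMultiplication-17643 · crux · rank 2 · open · by planner
why it might fail: Exact ranks are arithmetically rough: if optimal schemes live at sparse special sizes and the rest is padding, the excess R(<n>)/n^omega oscillates along EVERY tower (a dip after each efficient step) and no tower is monotone; nothing beyond the k = 0, N = 1 face (Blaser Thm 5.9) is checkable today.
sources: CoppersmithWinograd1982, Blaser2013, Zuiddam2015, Lacelle2026
[crux] MONOTONE TOWER (weakest load-bearing form of the law, rev 1): SOME Kronecker tower N, Nm,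
Nm^2, … (N >= 1, m >= 2) has monotone excess, m^omega · R(<N m^k>) <= R(<N m^(k+1)>) for every k;
implied by the general two-level law ExcessMonotone (support MonotoneTowerOfExcessMonotone, proved)
and hence by RM_MM / DR. Why it might fail: exact ranks are arithmetically rough — if optimal
schemes live at sparse special sizes and the rest is padding, the excess R(<n>)/n^omega oscillates
along EVERY tower (a dip after each efficient step) and no tower is monotone; no instance beyond the
k = 0, N = 1 face (Bläser Thm 5.9) is checkable today. Sources: CoppersmithWinograd1982, Blaser2013,
Zuiddam2015, Lacelle2026, card kronecker-ratio-law. [difficulty: open-problem] -/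
@[route_item "route-MatrixMultiplication-KroneckerRatioLaw", crux]
def MonotoneTower : Prop :=
  ∃ N m : ℕ, 1 ≤ N ∧ 2 ≤ m ∧ ∀ k : ℕ, (m : ℝ) ^ Literature.Computability.AlgebraicComplexity.omega ℂ * (Literature.Computability.AlgebraicComplexity.tensorRank (Literature.Computability.AlgebraicComplexity.matMulTensor ℂ (N * m ^ k) (N * m ^ k) (N * m ^ k)) : ℝ) ≤ (Literature.Computability.AlgebraicComplexity.tensorRank (Literature.Computability.AlgebraicComplexity.matMulTensor ℂ (N * m ^ (k + 1)) (N * m ^ (k + 1)) (N * m ^ (k + 1))) : ℝ)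

/-- item stmt-MatrixMultiplication-17707 · crux · rank 3 · open · by planner
why it might fail: False iff ONE tower keeps all its steps a fixed factor (1+eps0) above m^2, which is what omega > 2 predicts on every tower; no (1+eps)-efficient step is constructible by any known method (block recursion has step ratio R(<m>) >= 2.5m^2 - 3m > (1+eps) m^2).
sources: Blaser2013, CoppersmithWinograd1982, AlmanLi2026
[crux] EFFICIENT STEPS (rev-1 witness): EVERY Kronecker tower N, Nm, Nm^2, … (N >= 1, m >= 2) has,
for every eps > 0, a step k with R(<N m^(k+1)>) <= (1+eps) m^2 R(<N m^k>). A PROVED consequence of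
omega = 2 (support EfficientStepsOfExponentTwo, sorry-free in the planner folder: if every step cost
> (1+eps) m^2 then R(<N m^k>) > ((1+eps) m^2)^k against R(<n>) = O(n^(2+eta)), m^eta = sqrt(1+eps));
strictly weaker than the summit; implies the rev-0 witness TowerWitness; the weakest statement the
glue needs. Why it might fail: false iff ONE tower keeps all its steps a fixed factor (1+eps0) above
m^2, which is what omega > 2 predicts on every tower; no (1+eps)-efficient step is constructible by
any known method (block recursion has ratio R(<m>) >= 2.5 m^2 - 3m). Sources: Blaser2013,
CoppersmithWinograd1982, AlmanLi2026. [difficulty: open-problem] -/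
@[route_item "route-MatrixMultiplication-KroneckerRatioLaw", crux]
def EfficientSteps : Prop :=
  ∀ N m : ℕ, 1 ≤ N → 2 ≤ m → ∀ ε : ℝ, 0 < ε → ∃ k : ℕ, (Literature.Computability.AlgebraicComplexity.tensorRank (Literature.Computability.AlgebraicComplexity.matMulTensor ℂ (N * m ^ (k + 1)) (N * m ^ (k + 1)) (N * m ^ (k + 1))) : ℝ) ≤ (1 + ε) * (m : ℝ) ^ 2 * (Literature.Computability.AlgebraicComplexity.tensorRank (Literature.Computability.AlgebraicComplexity.matMulTensor ℂ (N * m ^ k) (N * m ^ k) (N * m ^ k)) : ℝ)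

/-- item stmt-MatrixMultiplication-19077 · support · rank 2 · open · by planner
why it might fail: Small formats are arithmetically rough (7 at N=2 is "too good"): a dip h(Nm) < h(N) at one small pair, e.g. R(<6,6,6>) <= 75 (law demands >= 4·R(<3,3,3>) >= 76), or R(<2m>) < 7·2^(omega-2) m^2, kills it; no instance beyond N = 1 is checkable today.
sources: CoppersmithWinograd1982, Blaser2013, Blaser1999, Zuiddam2015, Lacelle2026
[crux] MONOTONE EXCESS (two-level law): for all N >= 1, m >= 2, m^omega · R(<N,N,N>) <=
R(<Nm,Nm,Nm>), i.e. h(Nm) >= h(N) along divisibility; card kronecker-ratio-law ("c_k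
non-decreasing"), all bases. [difficulty: open-problem] -/
@[route_item "route-MatrixMultiplication-KroneckerRatioLaw"]
def ExcessMonotone : Prop :=
  ∀ N m : ℕ, 1 ≤ N → 2 ≤ m → (m : ℝ) ^ Literature.Computability.AlgebraicComplexity.omega ℂ * (Literature.Computability.AlgebraicComplexity.tensorRank (Literature.Computability.AlgebraicComplexity.matMulTensor ℂ N N N) : ℝ) ≤ (Literature.Computability.AlgebraicComplexity.tensorRank (Literature.Computability.AlgebraicComplexity.matMulTensor ℂ (N * m) (N * m) (N * m)) : ℝ)

/-- item stmt-MatrixMultiplication-19078 · support · rank 3 · open · by planner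
why it might fail: False iff along every tower all steps stay a fixed factor (1+eps0) above m^2, which follows from omega > 2.
sources: CoppersmithWinograd1982, Blaser2013
[crux] ONE efficient tower step: for every eps > 0 there are N >= 1, m >= 2 with R(<Nm,Nm,Nm>) <=
(1+eps) m^2 R(<N,N,N>). Implied by omega = 2 (support TowerWitnessOfExponentTwo, proved in the
planner folder); not implying it (one step); the weakest statement the glue needs. [difficulty:
open-problem] -/
@[route_item "route-MatrixMultiplication-KroneckerRatioLaw"]
def TowerWitness : Prop :=
  ∀ ε : ℝ, 0 < ε → ∃ N m : ℕ, 1 ≤ N ∧ 2 ≤ m ∧ (Literature.Computability.AlgebraicComplexity.tensorRank (Literature.Computability.AlgebraicComplexity.matMulTensor ℂ (N * m) (N * m) (N * m)) : ℝ) ≤ (1 + ε) * (m : ℝ) ^ 2 * (Literature.Computability.AlgebraicComplexity.tensorRank (Literature.Computability.AlgebraicComplexity.matMulTensor ℂ N N N) : ℝ)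

/-- item stmt-MatrixMultiplication-17721 · support · rank 9 · open · by planner
[support] the general two-level law (rev-0 crux ExcessMonotone, every pair (N, m)) gives a monotone
tower (the doubling tower N = 1, m = 2, or any other): instantiate at (N m^k, m). PROVED sorry-free
in the planner folder (Sketch2.lean monotoneTower_of_excessMonotone; evidence KRL_supports_holds).
Sources: Blaser2013. [difficulty: provable-now] -/
@[route_item "route-MatrixMultiplication-KroneckerRatioLaw"]
def MonotoneTowerOfExcessMonotone : Prop :=
  ExcessMonotone → MonotoneTower

/-- item stmt-MatrixMultiplication-17722 · support · rank 9 · open · by planner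
[support] exponent two (every 2+eta admissible) forces (1+eps)-efficient steps on EVERY Kronecker
tower: if all steps of the tower (N, m) cost > (1+eps) m^2 then R(<N m^k>) > ((1+eps) m^2)^k,
contradicting R(<n>) <= C n^(2+eta) with m^eta = sqrt(1+eps). PROVED sorry-free in the planner
folder (Sketch2.lean efficientSteps_of_exponent_two; evidence KRL_supports_holds); shows crux
EfficientSteps is a CONSEQUENCE of the summit. Sources: Blaser2013, CoppersmithWinograd1982.
[difficulty: provable-now] -/
@[route_item "route-MatrixMultiplication-KroneckerRatioLaw"]
def EfficientStepsOfExponentTwo : Prop :=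
  (∀ η : ℝ, 0 < η → (2 + η) ∈ Literature.Computability.AlgebraicComplexity.admissibleExponents ℂ) → EfficientSteps

/-- item stmt-MatrixMultiplication-17723 · support · rank 9 · open · by planner
[support] the rev-1 witness implies the rev-0 one-step witness: an efficient step k on the doubling
tower is the pair (2^k, 2). PROVED sorry-free in the planner folder (Sketch2.lean
towerWitness_of_efficientSteps). Sources: Blaser2013. [difficulty: provable-now] -/
@[route_item "route-MatrixMultiplication-KroneckerRatioLaw"]
def TowerWitnessOfEfficientSteps : Prop :=
  EfficientSteps → TowerWitness

/-- item stmt-MatrixMultiplication-19079 · support · rank 9 · open · by planner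
sources: Zuiddam2015, Blaser2013, ConnerGesmundoLandsbergVentura2022
[support] the card's second-order law RM_MM (ratio monotonicity: R(<n m^(k+2)>)·R(<n m^k>) <= R(<n
m^(k+1)>)^2 for n >= 1, m >= 2, all k) implies ExcessMonotone: a log-concave positive sequence a_k =
R(<N m^k>) with a_K >= N^omega (m^omega)^K (Bläser Thm 5.9) can never take a step below m^omega
(proof in hand: bc/ExcessMonotone_birth.lean + bc/MonotoneRatioFloor_proof.lean, sorry-free modulo
transcription). [difficulty: provable-now] -/
@[route_item "route-MatrixMultiplication-KroneckerRatioLaw"]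
def RatioLawGivesExcess : Prop :=
  (∀ n m k : ℕ, 1 ≤ n → 2 ≤ m → Literature.Computability.AlgebraicComplexity.tensorRank (Literature.Computability.AlgebraicComplexity.matMulTensor ℂ (n * m ^ (k + 2)) (n * m ^ (k + 2)) (n * m ^ (k + 2))) * Literature.Computability.AlgebraicComplexity.tensorRank (Literature.Computability.AlgebraicComplexity.matMulTensor ℂ (n * m ^ k) (n * m ^ k) (n * m ^ k)) ≤ Literature.Computability.AlgebraicComplexity.tensorRank (Literature.Computability.AlgebraicComplexity.matMulTensor ℂ (n * m ^ (k + 1)) (n * m ^ (k + 1)) (n * m ^ (k + 1))) ^ 2) → ∀ N m : ℕ, 1 ≤ N → 2 ≤ m → (m : ℝ) ^ Literature.Computability.AlgebraicComplexity.omega ℂ * (Literature.Computability.AlgebraicComplexity.tensorRank (Literature.Computability.AlgebraicComplexity.matMulTensor ℂ N N N) : ℝ) ≤ (Literature.Computability.AlgebraicComplexity.tensorRank (Literature.Computability.AlgebraicComplexity.matMulTensor ℂ (N * m) (N * m) (N * m)) : ℝ)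

/-- item stmt-MatrixMultiplication-19080 · support · rank 9 · open · by planner
sources: Blaser2013, Lacelle2026, Zuiddam2015
[support] DIMINISHING RETURNS of Kronecker factors — R(<N·M·m>)·R(<N>) <= R(<N·M>)·R(<N·m>) for all
N, M, m >= 1 (log R is DR-submodular on the divisor lattice of square formats; its N = 1 face is
submultiplicativity, a theorem; its M = m face is RM_MM) — implies ExcessMonotone (via RM_MM and
RatioLawGivesExcess). The hypothesis is this route's strongest typed form of the law; teeth:
7·R(<12,12,12>) <= R(<4,4,4>)·R(<6,6,6>) (records: 7·1040 = 7280 <= 48·153 = 7344). [difficulty: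
provable-now] -/
@[route_item "route-MatrixMultiplication-KroneckerRatioLaw"]
def DiminishingReturnsGivesExcess : Prop :=
  (∀ N M m : ℕ, 1 ≤ N → 1 ≤ M → 1 ≤ m → Literature.Computability.AlgebraicComplexity.tensorRank (Literature.Computability.AlgebraicComplexity.matMulTensor ℂ (N * M * m) (N * M * m) (N * M * m)) * Literature.Computability.AlgebraicComplexity.tensorRank (Literature.Computability.AlgebraicComplexity.matMulTensor ℂ N N N) ≤ Literature.Computability.AlgebraicComplexity.tensorRank (Literature.Computability.AlgebraicComplexity.matMulTensor ℂ (N * M) (N * M) (N * M)) * Literature.Computability.AlgebraicComplexity.tensorRank (Literature.Computability.AlgebraicComplexity.matMulTensor ℂ (N * m) (N * m) (N * m))) → ∀ N m : ℕ, 1 ≤ N → 2 ≤ m → (m : ℝ) ^ Literature.Computability.AlgebraicComplexity.omega ℂ * (Literature.Computability.AlgebraicComplexity.tensorRank (Literature.Computability.AlgebraicComplexity.matMulTensor ℂ N N N) : ℝ) ≤ (Literature.Computability.AlgebraicComplexity.tensorRank (Literature.Computability.AlgebraicComplexity.matMulTensor ℂ (N * m) (N * m) (N * m)) : ℝ)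

/-- item stmt-MatrixMultiplication-19081 · support · rank 9 · open · by planner
sources: Blaser2013, CoppersmithWinograd1982
[support] exponent two (every 2+eta admissible) implies TowerWitness: if every doubling step cost >
4(1+eps) then R(<2^k>) > (4(1+eps))^k, contradicting R(<n>) <= C n^(2+eta) with 2^eta = sqrt(1+eps).
PROVED sorry-free in the planner folder (bc/TowerWitness_of_omega_two.lean); shows crux 3 is a
consequence of the summit. [difficulty: provable-now] -/
@[route_item "route-MatrixMultiplication-KroneckerRatioLaw"]
def TowerWitnessOfExponentTwo : Prop :=
  (∀ η : ℝ, 0 < η → (2 + η) ∈ Literature.Computability.AlgebraicComplexity.admissibleExponents ℂ) → ∀ ε : ℝ, 0 < ε → ∃ N m : ℕ, 1 ≤ N ∧ 2 ≤ m ∧ (Literature.Computability.AlgebraicComplexity.tensorRank (Literature.Computability.AlgebraicComplexity.matMulTensor ℂ (N * m) (N * m) (N * m)) : ℝ) ≤ (1 + ε) * (m : ℝ) ^ 2 * (Literature.Computability.AlgebraicComplexity.tensorRank (Literature.Computability.AlgebraicComplexity.matMulTensor ℂ N N N) : ℝ)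

/-- item stmt-MatrixMultiplication-19082 · support · rank 9 · open · by planner
sources: Blaser2013
[support] the N = 1 face of ExcessMonotone, m^omega · R(<1,1,1>) <= R(<m,m,m>) for m >= 2, is Bläser
2013 Thm 5.9 with R(<1,1,1>) = 1 (BC5 special case, proved sorry-free in
bc/ExcessMonotone_special.lean). [difficulty: provable-now] -/
@[route_item "route-MatrixMultiplication-KroneckerRatioLaw"]
def PureTowerFace : Prop :=
  ∀ m : ℕ, 2 ≤ m → (m : ℝ) ^ Literature.Computability.AlgebraicComplexity.omega ℂ * (Literature.Computability.AlgebraicComplexity.tensorRank (Literature.Computability.AlgebraicComplexity.matMulTensor ℂ 1 1 1) : ℝ) ≤ (Literature.Computability.AlgebraicComplexity.tensorRank (Literature.Computability.AlgebraicComplexity.matMulTensor ℂ (1 * m) (1 * m) (1 * m)) : ℝ)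

-- earlier Assembly (stmt-MatrixMultiplication-19083, replaced 2026-08-17T04:21:21Z -> stmt-MatrixMultiplication-17741): retired by None — ExcessMonotone → TowerWitness → MatrixMultiplication
/-- item stmt-MatrixMultiplication-17741 · assembly · rank 1 · open · by planner
sources: Blaser2013
assembly (rev 1): MonotoneTower → EfficientSteps → omega(C) = 2 — literally the type of the deciding
theorem `closes` (proved); the rev-0 assembly ExcessMonotone → TowerWitness → omega(C) = 2 remains a
theorem (planner evidence KRL_supports_holds.lean, assembly_rev0). -/
@[route_item "route-MatrixMultiplication-KroneckerRatioLaw"]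
def Assembly : Prop :=
  MonotoneTower → EfficientSteps → MatrixMultiplication

/-! D-0027 §2.1 — DECIDING THEOREM (planner-authored via `route open/edit --closes-file`; by planner-plan-novel-MatrixMultiplication-MatrixM-c775de46-v2- 2026-08-17T04:19:59Z):
its hypotheses are this route's items and its conclusion the sub-problem Statement (glue_lint), and it elaborates with this file. -/

@[closes "route-MatrixMultiplication-KroneckerRatioLaw"] theorem closes (hL : MonotoneTower) (hW : EfficientSteps) : MatrixMultiplication := by
  show Literature.Computability.AlgebraicComplexity.omega ℂ = 2
  have h2 : (2 : ℝ) ≤ Literature.Computability.AlgebraicComplexity.omega ℂ :=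
    Literature.Computability.AlgebraicComplexity.omega_two_le ℂ
  refine le_antisymm ?_ h2
  refine le_of_forall_pos_le_add fun δ hδ => ?_
  obtain ⟨N, m, hN, hm, hlaw⟩ := hL
  have hlog2 : (0 : ℝ) < Real.log 2 := Real.log_pos one_lt_two
  have hε : (0 : ℝ) < δ * Real.log 2 := mul_pos hδ hlog2
  obtain ⟨k, hstep⟩ := hW N m hN hm (δ * Real.log 2) hε
  have hlawk := hlaw k
  have hm2 : (2 : ℝ) ≤ m := by exact_mod_cast hm
  have hm0 : (0 : ℝ) < m := by linarith
  have hg : (0 : ℝ) < (Literature.Computability.AlgebraicComplexity.tensorRank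
      (Literature.Computability.AlgebraicComplexity.matMulTensor ℂ
        (N * m ^ k) (N * m ^ k) (N * m ^ k)) : ℝ) := by
    have h := Literature.Computability.AlgebraicComplexity.matMulTensor_sq_le_tensorRank ℂ (N * m ^ k)
    have h1 : 1 ≤ (N * m ^ k) ^ 2 := Nat.one_le_pow _ _
      (Nat.one_le_iff_ne_zero.2 (Nat.mul_ne_zero (by omega) (pow_ne_zero _ (by omega))))
    exact_mod_cast lt_of_lt_of_le Nat.zero_lt_one (h1.trans h)
  have key : (m : ℝ) ^ Literature.Computability.AlgebraicComplexity.omega ℂ *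
        (Literature.Computability.AlgebraicComplexity.tensorRank
          (Literature.Computability.AlgebraicComplexity.matMulTensor ℂ
            (N * m ^ k) (N * m ^ k) (N * m ^ k)) : ℝ) ≤
      ((1 + δ * Real.log 2) * (m : ℝ) ^ 2) *
        (Literature.Computability.AlgebraicComplexity.tensorRank
          (Literature.Computability.AlgebraicComplexity.matMulTensor ℂ
            (N * m ^ k) (N * m ^ k) (N * m ^ k)) : ℝ) :=
    hlawk.trans hstep
  have key2 : (m : ℝ) ^ Literature.Computability.AlgebraicComplexity.omega ℂ ≤
      (1 + δ * Real.log 2) * (m : ℝ) ^ 2 := le_of_mul_le_mul_right key hg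
  have hlogm : Real.log 2 ≤ Real.log m := Real.log_le_log two_pos hm2
  have hlogm0 : (0 : ℝ) < Real.log m := lt_of_lt_of_le hlog2 hlogm
  have hlog1 : Real.log (1 + δ * Real.log 2) ≤ δ * Real.log 2 := by
    rw [Real.log_le_iff_le_exp (by positivity)]
    linarith [Real.add_one_le_exp (δ * Real.log 2)]
  have hlogkey := Real.log_le_log (Real.rpow_pos_of_pos hm0 _) key2
  rw [Real.log_rpow hm0, Real.log_mul (by positivity) (by positivity), Real.log_pow] at hlogkey
  push_cast at hlogkey
  have hδm : δ * Real.log 2 ≤ δ * Real.log m := mul_le_mul_of_nonneg_left hlogm hδ.le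
  by_contra hcon
  have hlt : 2 + δ < Literature.Computability.AlgebraicComplexity.omega ℂ := lt_of_not_ge hcon
  have hpos : (0 : ℝ) <
      (Literature.Computability.AlgebraicComplexity.omega ℂ - 2 - δ) * Real.log m :=
    mul_pos (by linarith) hlogm0
  nlinarith

end Summit.MatrixMultiplication.MatrixMultiplication.Theses.KroneckerRatioLaw
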